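import Summits.BirchSwinnertonDyer.BirchSwinnertonDyer.Theorems.ByReductionTypeAtTwoRankOneAtTwoBigImageOddLocalOneDoorKolyvaginExactBridgeC
import HarnessLib

/-!
# Route ByReductionTypeAtTwo, crux `RankOneAtTwoBigImageOddLocal` (stmt-BirchSwinnertonDyer-23715):
# the Manin-free K-side binder is LOSSLESS — crux ⟹ c-corrected exactness over `K` at every datum

Width prover seat `bsd-line-fkl-p2` g7 (2026-08-28), sequel of `…OneDoorKolyvaginExactBridgeC.lean` (p624011); `--supports
stmt-BirchSwinnertonDyer-23715`.  THEOREMS ONLY; nothing asserted; BSD is not proved by any of this.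

`…BridgeC.lean` derives the crux from ONE K-side binder `hXC` (for `W` on the slice and a Kolyvagin-admissible Heegner field `K`, at
every datum of any constant with `y_K` of infinite order and exact `2`-divisibility exponent `M₀`: `ord₂ #Ш(E_K)[2^∞] + 2 v₂(c) = 2 M₀`).
Here the CONVERSE: the tree's exactness-on-the-canonical-model iff `AdditivePotMult.missingPPartOverCAt_baseChange_iff_bsdp` (Milne 1972
any-model, GZK, modularity) turns `BSD(W, 2)` + `BSD(Wd, 2)` into `ord₂ #Ш_an(W ⊗ K) = ord₂ #Ш(W ⊗ K)`, and the Gross–Zagier identity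
`#Ш_an(W ⊗ K) = 4 I²/(c² w_K² (∏c_ℓ)²)` (`shaAnOverC_baseChange_eq_of_heegner`, any `c ≠ 0`) with `ord₂ I = M₀` reads it as the binder's
identity.  So, modulo PRINT (Gross–Zagier, Kolyvagin, GZK, modularity, Hoffstein–Luo, Milne 1972) and rank-`0` `BSD₂` of non-CM curves, the
three statements «crux 23715», «AN-28c» (lead, p621906/p622252 and `doorIndexLawFullCAtTwo_of_bsdp`) and «`hXC`» are EQUIVALENT:

* §1 `padicValRat_shaAnOverC_heegnerC` — at any datum: `∃ q, #Ш_an(W ⊗ K) = q ∧ ord₂ q = 2 M₀ − 2 v₂(c)` (the computation shared by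
  both directions; Gross–Zagier, GZK, modularity).
* §2 `shaExactC_of_bsdp_at` — PER DATUM: `BSD(W, 2)` and `BSD(Wd, 2)` ⟹ `ord₂ #Ш(E_K)[2^∞] + 2 v₂(c) = 2 M₀`.
* §3 `shaExactCAtTwo_of_crux` — the binder `hXC` of `rankOneAtTwoBigImageOddLocal_of_shaExactCAtTwo` FROM the crux, `S_rankZeroTwin` and
  PRINT; with §4 of `…BridgeC.lean` this is the iff `rankOneAtTwoBigImageOddLocal_iff_shaExactCAtTwo`.

References: [GrossZagier1986] V.§2; [GrossLMS1991] §2 Conj. (2.2), §4; [McCallumLMS1991] §5 Lemma 5.1; [Milne1972ArithmeticAV] §1 Thm. 1;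
[Miller2011LMS] Def. 1.1.
-/

set_option autoImplicit false
-- the Theorems namespace of this sub repeats the summit name by design (D-0017 nested layout)
set_option linter.dupNamespace false

noncomputable section

open scoped Classical

namespace Summit.BirchSwinnertonDyer.BirchSwinnertonDyer.Theorems.RankOneAtTwoOneDoor

open WeierstrassCurve NumberField Literature.NumberTheory.EllipticCurves Literature.NumberTheory.EllipticCurves.ModularForms
  Literature.NumberTheory.EllipticCurves.Rank1Residual
  Literature.NumberTheory.EllipticCurves.Rank1Residual.Typed
  Literature.NumberTheory.EllipticCurves.KrizLi2019
  Summit.BirchSwinnertonDyer.Rank1Residual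
  Summit.BirchSwinnertonDyer.Rank1Residual.AdditivePotMult
  Summit.BirchSwinnertonDyer.Rank1Residual.F1Sign2
  Summit.BirchSwinnertonDyer.Rank1Residual.F1Sign2.TranspositionDoor
  Summit.BirchSwinnertonDyer.BirchSwinnertonDyer.Theses.ByReductionTypeAtTwo
  Summit.BirchSwinnertonDyer.BirchSwinnertonDyer.Theorems.CMExactDescent

/-! ### §1 The shared computation: `ord₂ #Ш_an(W ⊗ K) = 2 M₀ − 2 v₂(c)` -/

/-- **`#Ш_an(W ⊗ K)` is a rational of `2`-adic valuation `2 M₀ − 2 v₂(c)`** at any datum: `W` globally minimal with `ρ̄_{W,2}` onto and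
odd `∏ c_ℓ`; `K` with odd `d_K ≠ −3` and the Heegner hypothesis; `Dt` any datum, `d₁` conductor-`1` with `2^{M₀} ∥ P(1)`;
`ord_{s=1} L(E_K, s) = 1`.  Also returned: `Ш(W ⊗ K)` is finite.  Gross–Zagier (`#Ш_an = 4I²/(c² w² (∏c)²)`, `shaAnOverC_baseChange_eq_of_heegner`),
`w_K = 2`, `ord₂ I = M₀` (`E(K)`, `E(K[1])` have no `2`-torsion). [cite: GrossZagier1986, V.§2 (pp. 310–312)] [cite: McCallumLMS1991, §5 Lemma 5.1] -/
theorem padicValRat_shaAnOverC_heegnerC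
    (W : WeierstrassCurve ℚ) [W.IsElliptic] [W.IsGloballyMinimal] [NeZero (W.conductorNorm ℤ)]
    (K : Type) [Field K] [NumberField K]
    (Dt : ModularParametrizationData W (W.conductorNorm ℤ)) (β : ℤ) (ι : K →+* ℂ) (d₁ : KolyvaginHeegnerData Dt β ι 1)
    (hGZ : gross_zagier (W.conductorNorm ℤ) W K)
    (hGZK : rank_eq_analyticRank_of_analyticRank_le_one) (hmod : hasEntireLFunction_rat)
    (hρ : W.HasSurjectiveModNGaloisRep 2) (hT : Odd W.tamagawaProduct)
    (hK : IsImaginaryQuadratic K) (hodd : Odd (NumberField.discr K)) (h3 : NumberField.discr K ≠ -3)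
    (hH : SatisfiesHeegnerHypothesis (W.conductorNorm ℤ) K)
    (hrK : (W.baseChange K).analyticRank = 1) {M₀ : ℕ}
    (hdiv : ∃ Q : (W.baseChange (ringClassField K ι 1)).toAffine.Point, ((2 ^ M₀ : ℕ) : ℤ) • Q = d₁.derivedPoint)
    (hndiv : ¬ ∃ Q : (W.baseChange (ringClassField K ι 1)).toAffine.Point, ((2 ^ (M₀ + 1) : ℕ) : ℤ) • Q = d₁.derivedPoint) :
    (W.baseChange K).ShaFinite ∧
      ∃ q : ℚ, shaAnOverC (W.baseChange K) = (q : ℂ) ∧ padicValRat 2 q = 2 * (M₀ : ℤ) - 2 * padicValInt 2 Dt.c := by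
  haveI : Fact (Nat.Prime 2) := ⟨Nat.prime_two⟩
  haveI hEK : (W.baseChange K).IsElliptic := isElliptic_baseChange' W K
  have h2 : Module.finrank ℚ K = 2 := hK.1
  obtain ⟨-, hDlt⟩ := discr_emod_four_and_lt_of_odd hK hodd h3
  have hw2 : Units.torsionOrder K = 2 :=
    Literature.NumberTheory.QuadraticFields.Quadratic.torsionOrder_eq_two_of_discr_lt_neg_four h2 hDlt
  have hc0 : Dt.c ≠ 0 := Dt.maninConstant_ne_zero_holds
  obtain ⟨P₀, Hd, hP₀, hP₀K⟩ := exists_heegnerPoint_map_eq_derivedPoint_one hK hH d₁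
  obtain ⟨hrkK, hShaK, hPinf, hshaCx⟩ := shaAnOverC_baseChange_eq_of_heegner W K Dt Hd ι P₀ hGZ
    hGZK hmod hK hH hP₀ hc0 hrK
  have htor1 : ∀ (M : ℕ) (R : (W.baseChange (ringClassField K ι 1)).toAffine.Point),
      ((2 ^ M : ℕ) : ℤ) • R = 0 → R = 0 :=
    fun M R hR ↦ eq_zero_of_two_pow_smul_eq_zero_ringClassField W hK hodd hH hρ ι M R hR
  have hdivK : ∃ Q : (W.baseChange K).toAffine.Point, ((2 ^ M₀ : ℕ) : ℤ) • Q = P₀ :=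
    (X11b.Three.Koly.pDiv_one_iff_exists_zsmul_eq hK d₁ P₀ hP₀K 2 M₀ (htor1 M₀)).mp hdiv
  have hndivK : ¬ ∃ Q : (W.baseChange K).toAffine.Point, ((2 ^ (M₀ + 1) : ℕ) : ℤ) • Q = P₀ :=
    fun h ↦ hndiv ((X11b.Three.Koly.pDiv_one_iff_exists_zsmul_eq hK d₁ P₀ hP₀K 2 (M₀ + 1)
      (htor1 (M₀ + 1))).mpr h)
  have hiv : ∀ x : (W.baseChange K).toAffine.Point, 2 • x = 0 → x = 0 :=
    fun x hx ↦ eq_zero_of_two_smul_eq_zero_baseChange W hK hodd hH hρ x hx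
  haveI : Finite (AddCommGroup.torsion (W.baseChange K).toAffine.Point) :=
    WeierstrassCurve.finite_torsion_point (W := W.baseChange K)
  obtain ⟨cc, Q, hcQ, hcker⟩ :=
    X11b.RankOne.exists_coord_of_mordellWeilRank_eq_one (W.baseChange K) hrkK
  have hidx : padicValNat 2 (AddSubgroup.zmultiples P₀).index = M₀ :=
    X11b.Three.Koly.padicValNat_index_zmultiples_eq_of_divisibility (p := 2) cc Q hcQ hcker hiv P₀
      hdivK hndivK
  set I := (AddSubgroup.zmultiples P₀).index with hI_def
  have hI0 : I ≠ 0 := fun hI ↦ by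
    have hh := P2.torsionOrder_sq_mul_canonicalHeight_eq_index_sq_mul_regulator (W.baseChange K)
      hrkK P₀ hPinf
    rw [← hI_def, hI, Nat.cast_zero, zero_pow two_ne_zero, zero_mul, mul_eq_zero,
      pow_eq_zero_iff two_ne_zero, Nat.cast_eq_zero] at hh
    exact hh.elim (W.baseChange K).torsionOrder_pos_holds.ne'
      (fun h0 ↦ hPinf ((Affine.Point.canonicalHeight_eq_zero_iff_holds P₀).mp h0))
  set q : ℚ := 4 * (I : ℚ) ^ 2 /
      ((Dt.c : ℚ) ^ 2 * (Units.torsionOrder K : ℚ) ^ 2 * ((W.tamagawaProduct : ℚ) ^ 2)) with hq_def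
  have hcQ0 : (Dt.c : ℚ) ≠ 0 := by exact_mod_cast hc0
  have hcW0 : (W.tamagawaProduct : ℚ) ≠ 0 := by exact_mod_cast W.tamagawaProduct_pos_holds.ne'
  have hIQ0 : (I : ℚ) ≠ 0 := by exact_mod_cast hI0
  have hq' : q = ((I : ℚ) / ((Dt.c : ℚ) * (W.tamagawaProduct : ℚ))) ^ 2 := by
    rw [hq_def, hw2]
    push_cast
    field_simp
    ring
  have hvc : padicValRat 2 (Dt.c : ℚ) = padicValInt 2 Dt.c := padicValRat.of_int
  have hvcW : padicValRat 2 (W.tamagawaProduct : ℚ) = 0 := by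
    rw [padicValRat.of_nat, padicValNat.eq_zero_of_not_dvd hT.not_two_dvd_nat]
    rfl
  refine ⟨hShaK, q, hshaCx, ?_⟩
  rw [hq', padicValRat.pow, padicValRat.div hIQ0 (mul_ne_zero hcQ0 hcW0),
    padicValRat.mul hcQ0 hcW0, hvc, hvcW, padicValRat.of_nat, hidx]
  push_cast
  ring

/-! ### §2 Per datum: `BSD(W, 2)` and `BSD(Wd, 2)` give the c-corrected exactness over `K` -/

/-- **c-corrected Kolyvagin exactness over `K` FROM `BSD₂` of the pair, PER DATUM.**  In the setting of §1 with `r_an(W) ≤ 1`, a globally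
minimal model `Wd` of the twist with `r_an(Wd) ≤ 1`: `BSD(W, 2)` and `BSD(Wd, 2)` give `ord₂ #Ш(E_K)[2^∞] + 2 v₂(c) = 2 M₀`
(`missingPPartOverCAt_baseChange_iff_bsdp`, `.mpr`, then §1 and `ord₂ #Ш = ord₂ #Ш[2^∞]`).
[cite: Milne1972ArithmeticAV, §1 Thm. 1] [cite: GrossZagier1986, V.§2] -/
theorem shaExactC_of_bsdp_at
    (W : WeierstrassCurve ℚ) [W.IsElliptic] [W.IsGloballyMinimal] [NeZero (W.conductorNorm ℤ)]
    (K : Type) [Field K] [NumberField K]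
    (Dt : ModularParametrizationData W (W.conductorNorm ℤ)) (β : ℤ) (ι : K →+* ℂ) (d₁ : KolyvaginHeegnerData Dt β ι 1)
    (Wd : WeierstrassCurve ℚ) [Wd.IsElliptic] [Wd.IsGloballyMinimal]
    (hGZ : gross_zagier (W.conductorNorm ℤ) W K)
    (hGZK : rank_eq_analyticRank_of_analyticRank_le_one) (hmod : hasEntireLFunction_rat)
    (hMilneC : Milne1972.bsdQuotient_baseChange_quadratic_anyModel)
    (hρ : W.HasSurjectiveModNGaloisRep 2) (hT : Odd W.tamagawaProduct) (hr : W.analyticRank ≤ 1)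
    (hK : IsImaginaryQuadratic K) (hodd : Odd (NumberField.discr K)) (h3 : NumberField.discr K ≠ -3)
    (hH : SatisfiesHeegnerHypothesis (W.conductorNorm ℤ) K)
    (hrK : (W.baseChange K).analyticRank = 1) {M₀ : ℕ}
    (hdiv : ∃ Q : (W.baseChange (ringClassField K ι 1)).toAffine.Point, ((2 ^ M₀ : ℕ) : ℤ) • Q = d₁.derivedPoint)
    (hndiv : ¬ ∃ Q : (W.baseChange (ringClassField K ι 1)).toAffine.Point, ((2 ^ (M₀ + 1) : ℕ) : ℤ) • Q = d₁.derivedPoint)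
    (hWd : ∃ C : VariableChange ℚ, C • W.quadraticTwist (NumberField.discr K : ℚ) = Wd)
    (hrd : Wd.analyticRank ≤ 1) (hBd : BSDp Wd 2) (hBW : BSDp W 2) :
    (padicValNat 2 (Nat.card (AddCommGroup.primaryComponent (W.baseChange K).sha 2)) : ℤ) + 2 * padicValInt 2 Dt.c = 2 * M₀ := by
  haveI : Fact (Nat.Prime 2) := ⟨Nat.prime_two⟩
  haveI hEK : (W.baseChange K).IsElliptic := isElliptic_baseChange' W K
  obtain ⟨hShaK, q, hq, hval⟩ := padicValRat_shaAnOverC_heegnerC W K Dt β ι d₁ hGZ hGZK hmod hρ hT hK hodd h3 hH hrK hdiv hndiv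
  haveI hfinK : Finite (W.baseChange K).sha := hShaK
  obtain ⟨q', hq', hv'⟩ := (missingPPartOverCAt_baseChange_iff_bsdp W 2 K Wd hGZK hmod hMilneC hr hK.1 hWd hrd hBd).mpr hBW
  have hqq : q' = q := Rat.cast_injective (α := ℂ) (hq'.symm.trans hq)
  rw [hqq, hval, X11b.Three.Koly.padicValNat_shaOrder_eq (W.baseChange K) 2] at hv'
  omega

/-! ### §3 The K-side binder from the crux: LOSSLESSNESS -/

/-- **The Manin-free K-side binder FROM the crux**: PRINT (`hGZ`, `hGZK`, `hmod`, `hMilneC`), rank-`0` `BSD₂` of non-CM curves (`hZ`)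
and the crux `RankOneAtTwoBigImageOddLocal` (`hcrux`, i.e. `BSD₂` on the slice) give, for every `W` on the slice (the binders
`Odd W.torsionOrder` of the crux is needed here to invoke it), every Kolyvagin-admissible `K`, every datum and conductor-`1` datum with
`y_K` of infinite order and exact exponent `M₀`: `ord₂ #Ш(E_K)[2^∞] + 2 v₂(c) = 2 M₀`.  (The non-square side conditions are idle.)
[cite: Milne1972ArithmeticAV, §1 Thm. 1] [cite: GrossLMS1991, §2 Conj. (2.2)] -/
theorem shaExactCAtTwo_of_crux
    (hGZ : ∀ (N : ℕ) [NeZero N] (W : WeierstrassCurve ℚ) (K : Type) [Field K] [NumberField K], gross_zagier N W K)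
    (hGZK : rank_eq_analyticRank_of_analyticRank_le_one) (hmod : hasEntireLFunction_rat)
    (hMilneC : Milne1972.bsdQuotient_baseChange_quadratic_anyModel) (hZ : S_rankZeroTwin)
    (hcrux : RankOneAtTwoBigImageOddLocal) :
    ∀ (W : WeierstrassCurve ℚ) [W.IsElliptic] [W.IsGloballyMinimal] [NeZero (W.conductorNorm ℤ)],
      ¬ W.HasCM → (∀ n : ℕ, W.HasSurjectiveModNGaloisRep ((2 ^ n : ℕ) : ℤ)) → Odd W.torsionOrder → Odd W.tamagawaProduct →
      W.analyticRank = 1 →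
      ∀ (K : Type) [Field K] [NumberField K], IsImaginaryQuadratic K → Odd (NumberField.discr K) →
        NumberField.discr K ≠ -3 → SatisfiesHeegnerHypothesis (W.conductorNorm ℤ) K →
        ∀ (Dt : ModularParametrizationData W (W.conductorNorm ℤ)) (β : ℤ) (ι : K →+* ℂ) (d₁ : KolyvaginHeegnerData Dt β ι 1),
          ¬ IsOfFinAddOrder d₁.derivedPoint → ∀ (M₀ : ℕ),
          (∃ Q : (W.baseChange (ringClassField K ι 1)).toAffine.Point, ((2 ^ M₀ : ℕ) : ℤ) • Q = d₁.derivedPoint) →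
          (¬ ∃ Q : (W.baseChange (ringClassField K ι 1)).toAffine.Point, ((2 ^ (M₀ + 1) : ℕ) : ℤ) • Q = d₁.derivedPoint) →
          (padicValNat 2 (Nat.card (AddCommGroup.primaryComponent (W.baseChange K).sha 2)) : ℤ) + 2 * padicValInt 2 Dt.c = 2 * M₀ := by
  intro W _ _ _ hCM hsurj hTo hc hr K _ _ hK hodd h3 hH Dt β ι d₁ hy M₀ hdiv hndiv
  have hρ2 : W.HasSurjectiveModNGaloisRep 2 := by
    have h := hsurj 1
    norm_num at h
    exact h
  have h2 : Module.finrank ℚ K = 2 := hK.1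
  have hBW : BSDp W 2 := hcrux W hCM hsurj hTo hc hr
  -- the twin: minimal model, non-CM, analytic rank `0`, `BSD(Wd, 2)`
  have hD0 : (NumberField.discr K : ℚ) ≠ 0 := by exact_mod_cast NumberField.discr_ne_zero K
  haveI hEt : (W.quadraticTwist (NumberField.discr K : ℚ)).IsElliptic := W.isElliptic_quadraticTwist hD0
  obtain ⟨Cd, hCd⟩ := hasGlobalMinimalModel_rat_holds (W.quadraticTwist (NumberField.discr K : ℚ))
  haveI : (Cd • W.quadraticTwist (NumberField.discr K : ℚ)).IsGloballyMinimal := hCd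
  have hCMd : ¬ (Cd • W.quadraticTwist (NumberField.discr K : ℚ)).HasCM :=
    RamifiedPairUpperBound.not_hasCM_of_smul_quadraticTwist_eq hD0 rfl hCM
  obtain ⟨P₀, Hd, hP₀, hP₀K⟩ := exists_heegnerPoint_map_eq_derivedPoint_one hK hH d₁
  have hPinf : ¬ IsOfFinAddOrder P₀ := by
    intro hfin
    apply hy
    rw [← hP₀K]
    exact (WeierstrassCurve.Affine.Point.map (W' := W)
      (algebraMap K (ringClassField K ι 1)).toRatAlgHom).isOfFinAddOrder hfin
  have hLK : LDerivEK W K ≠ 0 :=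
    (lDerivEK_ne_zero_iff_not_isOfFinAddOrder W (W.conductorNorm ℤ) K (hGZ _ W K) hK hH ⟨Dt, Hd, ι, hP₀⟩).mpr hPinf
  have hL0 : W.entireLFunction 1 = 0 := entireLFunction_one_eq_zero_of_analyticRank_eq_one hr
  have hLt : (W.quadraticTwist (NumberField.discr K : ℚ)).entireLFunction 1 ≠ 0 := by
    intro h0
    apply hLK
    rw [lDerivEK_eq_deriv_mul W K hmod hL0, h0, mul_zero]
  have hrt : (W.quadraticTwist (NumberField.discr K : ℚ)).analyticRank = 0 :=
    ((W.quadraticTwist _).analyticRank_eq_zero_iff_holds (hmod _)).mpr hLt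
  have hrd : (Cd • W.quadraticTwist (NumberField.discr K : ℚ)).analyticRank = 0 := by
    rw [analyticRank_smul, hrt]
  have hBd : BSDp (Cd • W.quadraticTwist (NumberField.discr K : ℚ)) 2 := hZ _ hCMd hrd
  have hrK : (W.baseChange K).analyticRank = 1 :=
    (P2.analyticRank_baseChange_eq_one_iff W K hmod h2).mpr (Or.inl ⟨hr, hrt⟩)
  exact shaExactC_of_bsdp_at W K Dt β ι d₁ (Cd • W.quadraticTwist (NumberField.discr K : ℚ)) (hGZ _ W K) hGZK hmod hMilneC hρ2 hc
    hr.le hK hodd h3 hH hrK hdiv hndiv ⟨Cd, rfl⟩ (by rw [hrd]; exact zero_le_one) hBd hBW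

/-- **The crux from the K-side binder carrying the slice's odd-torsion hypothesis** (the form in which the converse §3 delivers it):
as `rankOneAtTwoBigImageOddLocal_of_shaExactCAtTwo` (`…BridgeC.lean` §4), whose binder omits `Odd W.torsionOrder`; same assembly
(door `exists_kolyvaginDoorField_of_analyticRank_eq_one`, datum from modularity, `β`, `d₁`, `y_K` non-torsion, `M₀`), then
`bsdp_two_of_shaExactC_at`. BSD is not proved by this: conditional by design. [cite: GrossLMS1991, §2 Conj. (2.2) and §4] -/
theorem rankOneAtTwoBigImageOddLocal_of_shaExactCAtTwo'
    (hGZ : ∀ (N : ℕ) [NeZero N] (W : WeierstrassCurve ℚ) (K : Type) [Field K] [NumberField K], gross_zagier N W K)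
    (hGZK : rank_eq_analyticRank_of_analyticRank_le_one) (hnf : exists_isNewformOf)
    (hHL : HoffsteinLuo1997_exists_twist_L_one_ne_zero) (hMilneC : Milne1972.bsdQuotient_baseChange_quadratic_anyModel)
    (hXC : ∀ (W : WeierstrassCurve ℚ) [W.IsElliptic] [W.IsGloballyMinimal] [NeZero (W.conductorNorm ℤ)],
      ¬ W.HasCM → (∀ n : ℕ, W.HasSurjectiveModNGaloisRep ((2 ^ n : ℕ) : ℤ)) → Odd W.torsionOrder → Odd W.tamagawaProduct →
      W.analyticRank = 1 →
      ∀ (K : Type) [Field K] [NumberField K], IsImaginaryQuadratic K → Odd (NumberField.discr K) →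
        NumberField.discr K ≠ -3 → SatisfiesHeegnerHypothesis (W.conductorNorm ℤ) K →
        ¬ IsSquare ((NumberField.discr K : ℚ) * -|W.Δ|) → ¬ IsSquare ((NumberField.discr K : ℚ) * (-(2 * |W.Δ|))) →
        ∀ (Dt : ModularParametrizationData W (W.conductorNorm ℤ)) (β : ℤ) (ι : K →+* ℂ) (d₁ : KolyvaginHeegnerData Dt β ι 1),
          ¬ IsOfFinAddOrder d₁.derivedPoint → ∀ (M₀ : ℕ),
          (∃ Q : (W.baseChange (ringClassField K ι 1)).toAffine.Point, ((2 ^ M₀ : ℕ) : ℤ) • Q = d₁.derivedPoint) →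
          (¬ ∃ Q : (W.baseChange (ringClassField K ι 1)).toAffine.Point, ((2 ^ (M₀ + 1) : ℕ) : ℤ) • Q = d₁.derivedPoint) →
          (padicValNat 2 (Nat.card (AddCommGroup.primaryComponent (W.baseChange K).sha 2)) : ℤ) + 2 * padicValInt 2 Dt.c = 2 * M₀)
    (hZ : S_rankZeroTwin) : RankOneAtTwoBigImageOddLocal := by
  intro W _ _ hCM hsurj hT hc hr
  haveI hN : NeZero (W.conductorNorm ℤ) := ⟨(W.conductorNorm_pos_holds).ne'⟩
  have hmod : hasEntireLFunction_rat := hasEntireLFunction_rat_of_exists_isNewformOf hnf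
  obtain ⟨K, _iF, _iN, hK, hodd, h3, hH, hsq1, hsq2, -, hLt, -⟩ :=
    exists_kolyvaginDoorField_of_analyticRank_eq_one hnf hHL W hr
  obtain ⟨Dt⟩ := (nonempty_modularParametrizationData_iff_exists_isNewformOf_unconditional.mpr hnf) W
  obtain ⟨β, hβ⟩ : ∃ β : ℤ, (4 * (W.conductorNorm ℤ : ℕ) : ℤ) ∣ β ^ 2 - NumberField.discr K :=
    Literature.NumberTheory.QuadraticFields.Quadratic.exists_dvd_sq_sub_discr_of_ncard_primesOver hK.1 (NeZero.ne _) hH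
  obtain ⟨ι⟩ : Nonempty (K →+* ℂ) := inferInstance
  obtain ⟨d₁⟩ := exists_kolyvaginHeegnerData_one
    (phi_heegnerTau_mem_singularModuliField_holds (W.conductorNorm ℤ) W K) hK Dt β ι hβ
  haveI hEK : (W.baseChange K).IsElliptic := isElliptic_baseChange' W K
  have hL0 : W.entireLFunction 1 = 0 := entireLFunction_one_eq_zero_of_analyticRank_eq_one hr
  obtain ⟨-, hderiv⟩ := leadingLCoeff_eq_deriv_of_analyticRank_eq_one hr
  have hLK : LDerivEK W K ≠ 0 := by
    rw [lDerivEK_eq_deriv_mul W K hmod hL0]; exact mul_ne_zero hderiv hLt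
  obtain ⟨P₀, Hd, hP₀, hP₀K⟩ := exists_heegnerPoint_map_eq_derivedPoint_one hK hH d₁
  have hP₀inf : ¬ IsOfFinAddOrder P₀ :=
    (lDerivEK_ne_zero_iff_not_isOfFinAddOrder W (W.conductorNorm ℤ) K (hGZ _ W K) hK hH ⟨Dt, Hd, ι, hP₀⟩).mp hLK
  have hy : ¬ IsOfFinAddOrder d₁.derivedPoint := by
    intro hfin
    apply hP₀inf
    rw [← hP₀K] at hfin
    exact (WeierstrassCurve.Affine.Point.map_injective (W' := W) _).isOfFinAddOrder_iff.mp hfin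
  obtain ⟨M₀, hdiv, hndiv⟩ : ∃ M₀ : ℕ,
      (∃ Q : (W.baseChange (ringClassField K ι 1)).toAffine.Point, ((2 ^ M₀ : ℕ) : ℤ) • Q = d₁.derivedPoint) ∧
      ¬ ∃ Q : (W.baseChange (ringClassField K ι 1)).toAffine.Point, ((2 ^ (M₀ + 1) : ℕ) : ℤ) • Q = d₁.derivedPoint := by
    haveI : NumberField (ringClassField K ι 1) := numberField_ringClassField hK ι one_ne_zero
    haveI : (W.baseChange (ringClassField K ι 1)).IsElliptic := by rw [baseChange]; infer_instance
    haveI : Module.Finite ℤ (W.baseChange (ringClassField K ι 1)).toAffine.Point := by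
      convert (W.baseChange (ringClassField K ι 1)).module_finite_point_holds
    exact exists_pow_smul_eq_and_not_of_not_isOfFinAddOrder Nat.prime_two hy
  have hshaC := hXC W hCM hsurj hT hc hr K hK hodd h3 hH hsq1 hsq2 Dt β ι d₁ hy M₀ hdiv hndiv
  exact bsdp_two_of_shaExactC_at hGZ hGZK hmod hMilneC hZ W hCM hsurj hc hr K hK hodd h3 hH Dt β ι d₁ hy M₀ hdiv hndiv hshaC

/-- **LOSSLESSNESS of the Manin-free K-side split, BY NAME**: modulo PRINT (Gross–Zagier, GZK, modularity as a newform, Hoffstein–Luo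
1997, Milne 1972) and rank-`0` `BSD₂` of non-CM curves, the crux `RankOneAtTwoBigImageOddLocal` is EQUIVALENT to the c-corrected `2`-part
of Gross's Conjecture (2.2) over `K` at conductor `1` on the slice's Kolyvagin-admissible doors (the binder of
`rankOneAtTwoBigImageOddLocal_of_shaExactCAtTwo'`).  BSD is not proved by this: conditional by design.
[cite: GrossLMS1991, §2 Conj. (2.2) and §4] [cite: Milne1972ArithmeticAV, §1 Thm. 1] -/
theorem rankOneAtTwoBigImageOddLocal_iff_shaExactCAtTwo
    (hGZ : ∀ (N : ℕ) [NeZero N] (W : WeierstrassCurve ℚ) (K : Type) [Field K] [NumberField K], gross_zagier N W K)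
    (hGZK : rank_eq_analyticRank_of_analyticRank_le_one) (hnf : exists_isNewformOf)
    (hHL : HoffsteinLuo1997_exists_twist_L_one_ne_zero) (hMilneC : Milne1972.bsdQuotient_baseChange_quadratic_anyModel)
    (hZ : S_rankZeroTwin) :
    RankOneAtTwoBigImageOddLocal ↔
      ∀ (W : WeierstrassCurve ℚ) [W.IsElliptic] [W.IsGloballyMinimal] [NeZero (W.conductorNorm ℤ)],
        ¬ W.HasCM → (∀ n : ℕ, W.HasSurjectiveModNGaloisRep ((2 ^ n : ℕ) : ℤ)) → Odd W.torsionOrder → Odd W.tamagawaProduct →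
        W.analyticRank = 1 →
        ∀ (K : Type) [Field K] [NumberField K], IsImaginaryQuadratic K → Odd (NumberField.discr K) →
          NumberField.discr K ≠ -3 → SatisfiesHeegnerHypothesis (W.conductorNorm ℤ) K →
          ¬ IsSquare ((NumberField.discr K : ℚ) * -|W.Δ|) → ¬ IsSquare ((NumberField.discr K : ℚ) * (-(2 * |W.Δ|))) →
          ∀ (Dt : ModularParametrizationData W (W.conductorNorm ℤ)) (β : ℤ) (ι : K →+* ℂ) (d₁ : KolyvaginHeegnerData Dt β ι 1),
            ¬ IsOfFinAddOrder d₁.derivedPoint → ∀ (M₀ : ℕ),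
            (∃ Q : (W.baseChange (ringClassField K ι 1)).toAffine.Point, ((2 ^ M₀ : ℕ) : ℤ) • Q = d₁.derivedPoint) →
            (¬ ∃ Q : (W.baseChange (ringClassField K ι 1)).toAffine.Point, ((2 ^ (M₀ + 1) : ℕ) : ℤ) • Q = d₁.derivedPoint) →
            (padicValNat 2 (Nat.card (AddCommGroup.primaryComponent (W.baseChange K).sha 2)) : ℤ) + 2 * padicValInt 2 Dt.c =
              2 * M₀ :=
  ⟨fun hcrux W _ _ _ hCM hsurj hTo hc hr K _ _ hK hodd h3 hH _ _ Dt β ι d₁ hy M₀ hdiv hndiv =>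
      shaExactCAtTwo_of_crux hGZ hGZK (hasEntireLFunction_rat_of_exists_isNewformOf hnf) hMilneC hZ hcrux W hCM hsurj hTo hc hr K hK
        hodd h3 hH Dt β ι d₁ hy M₀ hdiv hndiv,
    fun hXC => rankOneAtTwoBigImageOddLocal_of_shaExactCAtTwo' hGZ hGZK hnf hHL hMilneC hXC hZ⟩

end Summit.BirchSwinnertonDyer.BirchSwinnertonDyer.Theorems.RankOneAtTwoOneDoor

end
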